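import Summits.BirchSwinnertonDyer.BirchSwinnertonDyer.Theorems.KolyvaginRoadThreeSchneiderTamAtThreeHeightLogNumeratorDeepWeierstrassP
import HarnessLib

/-!
# Crux `SchneiderTamAtThree` (item 19154) — THE HEIGHT IS THE LOGARITHM OF THE NUMERATOR, DEEP POINTS,
# part 3a/4: the logarithms of the two factors `x·ℓ²` and `2(ch L − 1)/L` to second order

HONEST FRAMING (cell `bsd-stepL`, seat `bsd-stepL-tam3-p2` g2, WIDTH-LEVER second lane «closed-form Schneider
local factor at 3 … finite case table proved once»; `--supports stmt-BirchSwinnertonDyer-19154 --as helper`):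
THEOREMS ONLY, unconditional, route-independent (no Theses import); 0 definitions, 0 named facts, 0 sorry;
nothing here proves the crux `SchneiderTamAtThree`, Schneider's conjecture or BSD. The height is
`ĥ₃ = log₃ den x − log₃ Σ²` with `x·Σ² = (x·ℓ²)·(2(ch L − 1)/L)·Π` (`L = ℓ²/C²`); this file expands the
Iwasawa logarithms of the first two factors to the precision `‖z‖⁴` needed by the deep-point law (part 3b).

* `norm_padicLog_x_mul_formalLog_sq_sub_le` — for a `3`-integral equation over `ℚ₃` and a point with
  `‖z‖₃ ≤ 3⁻²`: **`‖log₃(x·ℓ²) − (−(b₂/12)ℓ² + (c₄/240 − b₂²/288)ℓ⁴)‖₃ ≤ ‖x‖₃⁻²`** (part 2b's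
  `x·ℓ² = 1 − (b₂/12)ℓ² + (c₄/240)ℓ⁴ + O(‖x‖⁻²)` and `log₃(1+u) = u − u²/2 + O(3‖u‖³)`).
* `norm_padicLog_two_mul_coshOfSq_sub_one_div_sub_le` — for `0 < ‖L‖₃ ≤ 3⁻⁴`:
  **`‖log₃(2(ch L − 1)/L) − (L/12 − L²/1440)‖₃ ≤ 81‖L‖₃³`** (`2(ch L − 1)/L = 1 + L/12 + L²/360 + O(9L³)`,
  and `1/360 − 1/288 = −1/1440`).

References: [SteinWuthrich2013] §4.1–4.2; [Iwasawa1972PadicL] §4.4; [SilvermanAEC2009] IV.1, IV.6; tree: parts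
1, 2a, 2b of the deep chain, `…SecondOrderSeries` (`cosh` to third order).
-/

noncomputable section

open scoped Classical Nat
open Filter Topology IsUltrametricDist PowerSeries
open WeierstrassCurve Literature.NumberTheory.EllipticCurves
open Literature.NumberTheory.EllipticCurves.SteinWuthrich2013
open Literature.NumberTheory.EllipticCurves.TateCurve
open Literature.NumberTheory.EllipticCurves.Rank1Residual
open Summit.BirchSwinnertonDyer.Uniform.UI.O2

namespace Summit.BirchSwinnertonDyer.Rank1Residual.X11b.RegMult.HeightLogNumerator

/-! ### §6 `log₃(x·ℓ²)` to second order -/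

section LogFactors

variable (V : WeierstrassCurve ℚ_[3]) [V.IsIntegral ℤ_[3]]

/-- **`log₃(x·ℓ²) = −(b₂/12)ℓ² + (c₄/240 − b₂²/288)ℓ⁴ + O(‖x‖⁻²)`** for a `3`-integral equation over `ℚ₃`
and a point `(x, y)` with `‖z‖₃ ≤ 3⁻²` (`z = −x/y`, `ℓ = log_W z`): with `u = x·ℓ² − 1 =
−(b₂/12)ℓ² + (c₄/240)ℓ⁴ + O(‖x‖⁻²)` (part 2b; `‖u‖ ≤ 3‖z‖²`), `log₃(1+u) = u − u²/2 + O(3‖u‖³)` (part 1) and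
`u² = (b₂²/144)ℓ⁴ + O(9‖z‖⁶)`; all error terms are `≤ ‖z‖⁴ = ‖x‖⁻²` because `‖z‖ ≤ 3⁻²`.
[cite: SilvermanAEC2009, IV.1, IV.6.4] [cite: Iwasawa1972PadicL, §4.4] -/
theorem norm_padicLog_x_mul_formalLog_sq_sub_le {x y : ℚ_[3]} (heq : V.toAffine.Equation x y)
    (hx : 1 < ‖x‖) (hz9 : ‖-x / y‖ ≤ 1 / 9) :
    ‖padicLog 3 (x * V.padicFormalLog (-x / y) ^ 2) -
        (-(V.b₂ / 12) * V.padicFormalLog (-x / y) ^ 2 +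
          (V.c₄ / 240 - V.b₂ ^ 2 / 288) * V.padicFormalLog (-x / y) ^ 4)‖ ≤ ‖x‖⁻¹ ^ 2 := by
  set z : ℚ_[3] := -x / y with hzdef
  set ℓ : ℚ_[3] := V.padicFormalLog z with hℓdef
  obtain ⟨hsq, hxyn⟩ := V.norm_sq_eq_norm_cube heq hx
  have hx0 : 0 < ‖x‖ := one_pos.trans hx
  have hy0n : 0 < ‖y‖ := hx0.trans hxyn
  have hz2 : ‖z‖ ^ 2 = ‖x‖⁻¹ := by
    rw [hzdef, norm_div, norm_neg, div_pow, hsq]; field_simp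
  have hzz : 0 < ‖z‖ := by rw [hzdef, norm_div, norm_neg]; positivity
  have hz3 : ‖z‖ ≤ 1 / 3 := hz9.trans (by norm_num)
  have hr4 : ‖x‖⁻¹ ^ 2 = ‖z‖ ^ 4 := by rw [← hz2]; ring
  obtain ⟨hz1, h3z, h9z, h27z2, h3z2, hz2le, -, hr6, -, -, -, h3r5, hr6', -⟩ := deep_numerics ‖z‖ hzz hz9
  obtain ⟨h2n, h4n, h3n, h3i, h9i, h12i, -, -, -, -⟩ := padic_three_constants
  have h81 : 81 * ‖z‖ ^ 2 ≤ 1 := by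
    calc 81 * ‖z‖ ^ 2 = (9 * ‖z‖) * (9 * ‖z‖) := by ring
      _ ≤ 1 * 1 := mul_le_mul h9z h9z (by positivity) zero_le_one
      _ = 1 := one_mul _
  have hr42 : ‖z‖ ^ 4 ≤ ‖z‖ ^ 2 := by
    calc ‖z‖ ^ 4 = ‖z‖ ^ 2 * ‖z‖ ^ 2 := by ring
      _ ≤ ‖z‖ ^ 2 * 1 := by gcongr; exact pow_le_one₀ (norm_nonneg _) hz1
      _ = ‖z‖ ^ 2 := mul_one _
  -- the input of part 2b and the size of `ℓ`
  have hA : ‖x * ℓ ^ 2 - 1 + V.b₂ / 12 * ℓ ^ 2 - V.c₄ / 240 * ℓ ^ 4‖ ≤ ‖z‖ ^ 4 := by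
    have h := norm_x_mul_formalLog_sq_sub_le V heq hx hz9
    rw [hr4] at h
    exact h
  have hτ := norm_padicFormalLog_sub_cubic_le_pow_four V hz3
  have hℓn : ‖ℓ‖ ≤ ‖z‖ := by
    obtain ⟨ha1, ha2, -, -, -⟩ := V.norm_coeffs_le_one
    have e : ℓ = (ℓ - (z + (2 : ℚ_[3])⁻¹ * V.a₁ * z ^ 2 + (3 : ℚ_[3])⁻¹ * (V.a₁ ^ 2 + V.a₂) * z ^ 3)) +
        (z + (2 : ℚ_[3])⁻¹ * V.a₁ * z ^ 2 + (3 : ℚ_[3])⁻¹ * (V.a₁ ^ 2 + V.a₂) * z ^ 3) := by ring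
    rw [e]
    refine (norm_add_le_max _ _).trans (max_le (hτ.trans ?_) ((norm_add_le_max _ _).trans (max_le
      ((norm_add_le_max _ _).trans (max_le le_rfl ?_)) ?_)))
    · calc ‖z‖ ^ 4 = ‖z‖ ^ 3 * ‖z‖ := by ring
        _ ≤ 1 * ‖z‖ := by gcongr; exact pow_le_one₀ (norm_nonneg _) hz1
        _ = ‖z‖ := one_mul _
    · rw [norm_mul, norm_mul, norm_inv, h2n, inv_one, one_mul, norm_pow]
      calc ‖V.a₁‖ * ‖z‖ ^ 2 ≤ 1 * ‖z‖ ^ 2 := by gcongr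
        _ ≤ ‖z‖ := by rw [one_mul]; exact hz2le
    · rw [norm_mul, norm_mul, h3i, norm_pow]
      have ha12 : ‖V.a₁ ^ 2 + V.a₂‖ ≤ 1 := (norm_add_le_max _ _).trans
        (max_le (by rw [norm_pow]; exact pow_le_one₀ (norm_nonneg _) ha1) ha2)
      calc 3 * ‖V.a₁ ^ 2 + V.a₂‖ * ‖z‖ ^ 3 ≤ 3 * 1 * ‖z‖ ^ 3 := by gcongr
        _ = (3 * ‖z‖ ^ 2) * ‖z‖ := by ring
        _ ≤ 1 * ‖z‖ := by gcongr
        _ = ‖z‖ := one_mul _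
  -- `b₂, c₄` are integral
  have hb2 : ‖V.b₂‖ ≤ 1 := by
    have e := congrArg WeierstrassCurve.b₂ V.eq_map_integralModel
    rw [map_b₂] at e
    rw [← e]; exact PadicInt.norm_le_one _
  have hc4 : ‖V.c₄‖ ≤ 1 := by
    have e := congrArg WeierstrassCurve.c₄ V.eq_map_integralModel
    rw [map_c₄] at e
    rw [← e]; exact PadicInt.norm_le_one _
  have h240i : ‖(240 : ℚ_[3])⁻¹‖ = 3 := by
    have h80 : ‖(80 : ℚ_[3])‖ = 1 := by
      simpa using Padic.norm_natCast_eq_one_iff.mpr (show Nat.Coprime 3 80 by decide)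
    rw [show (240 : ℚ_[3]) = 80 * 3 by norm_num, mul_inv, norm_mul, h3i, norm_inv, h80]; norm_num
  have hb12 : ‖V.b₂ / 12‖ ≤ 3 := by
    rw [div_eq_mul_inv, norm_mul, h12i]
    calc ‖V.b₂‖ * 3 ≤ 1 * 3 := by gcongr
      _ = 3 := one_mul _
  have hc240 : ‖V.c₄ / 240‖ ≤ 3 := by
    rw [div_eq_mul_inv, norm_mul, h240i]
    calc ‖V.c₄‖ * 3 ≤ 1 * 3 := by gcongr
      _ = 3 := one_mul _
  clear_value z ℓ
  -- `u = x ℓ² − 1 = A + E`, `A = −(b₂/12)ℓ²`, `‖E‖ ≤ 3‖z‖⁴`, `‖u‖ ≤ 3‖z‖²`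
  set u : ℚ_[3] := x * ℓ ^ 2 - 1 with hudef
  set A : ℚ_[3] := -(V.b₂ / 12) * ℓ ^ 2 with hAdef
  set g : ℚ_[3] := x * ℓ ^ 2 - 1 + V.b₂ / 12 * ℓ ^ 2 - V.c₄ / 240 * ℓ ^ 4 with hgdef
  have hg : ‖g‖ ≤ ‖z‖ ^ 4 := hA
  have hE_eq : u - A = V.c₄ / 240 * ℓ ^ 4 + g := by rw [hudef, hAdef, hgdef]; ring
  have hℓ4 : ‖ℓ ^ 4‖ ≤ ‖z‖ ^ 4 := by rw [norm_pow]; exact pow_le_pow_left₀ (norm_nonneg _) hℓn 4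
  have hE : ‖u - A‖ ≤ 3 * ‖z‖ ^ 4 := by
    rw [hE_eq]
    have hz4 : ‖z‖ ^ 4 ≤ 3 * ‖z‖ ^ 4 := le_mul_of_one_le_left (pow_nonneg (norm_nonneg z) 4) (by norm_num)
    refine (norm_add_le_max _ _).trans (max_le ?_ (hg.trans hz4))
    rw [norm_mul]
    exact mul_le_mul hc240 hℓ4 (norm_nonneg _) (by norm_num)
  have hAn : ‖A‖ ≤ 3 * ‖z‖ ^ 2 := by
    rw [hAdef, norm_mul, norm_neg, norm_pow]
    exact mul_le_mul hb12 (pow_le_pow_left₀ (norm_nonneg _) hℓn 2) (by positivity) (by norm_num)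
  have hun : ‖u‖ ≤ 3 * ‖z‖ ^ 2 := by
    rw [show u = (u - A) + A by ring]
    refine (norm_add_le_max _ _).trans (max_le (hE.trans ?_) hAn)
    linarith [hr42]
  have hu3 : ‖u‖ ≤ 1 / 3 := hun.trans (by linarith [h27z2])
  -- `log(1 + u) = u − u²/2 + O(3‖u‖³)`
  have hlog := norm_padicLog_one_add_sub_sub_le hu3
  have h1u : 1 + u = x * ℓ ^ 2 := by rw [hudef]; ring
  rw [h1u] at hlog
  -- `u² = A² + (u − A)(u + A)`, `A² = (b₂²/144) ℓ⁴`
  have hfin : padicLog 3 (x * ℓ ^ 2) - (-(V.b₂ / 12) * ℓ ^ 2 + (V.c₄ / 240 - V.b₂ ^ 2 / 288) * ℓ ^ 4) =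
      (padicLog 3 (x * ℓ ^ 2) - (u - u ^ 2 / 2)) + g - (2 : ℚ_[3])⁻¹ * ((u - A) * (u + A)) := by
    rw [hgdef, hudef, hAdef]; ring
  rw [hfin, hr4]
  have h9z2 : 9 * ‖z‖ ^ 2 ≤ 1 := by linarith [h27z2]
  refine (norm_sub_le_max₃ _ _).trans (max_le ((norm_add_le_max _ _).trans (max_le (hlog.trans ?_) hg)) ?_)
  · calc 3 * ‖u‖ ^ 3 ≤ 3 * (3 * ‖z‖ ^ 2) ^ 3 := by gcongr
      _ = (81 * ‖z‖ ^ 2) * ‖z‖ ^ 4 := by ring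
      _ ≤ 1 * ‖z‖ ^ 4 := by gcongr
      _ = ‖z‖ ^ 4 := one_mul _
  · rw [norm_mul, norm_inv, h2n, inv_one, one_mul, norm_mul]
    have huA : ‖u + A‖ ≤ 3 * ‖z‖ ^ 2 := (norm_add_le_max _ _).trans (max_le hun hAn)
    calc ‖u - A‖ * ‖u + A‖ ≤ (3 * ‖z‖ ^ 4) * (3 * ‖z‖ ^ 2) := by gcongr
      _ = (9 * ‖z‖ ^ 2) * ‖z‖ ^ 4 := by ring
      _ ≤ 1 * ‖z‖ ^ 4 := by gcongr
      _ = ‖z‖ ^ 4 := one_mul _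

end LogFactors

/-! ### §7 `log₃(2(ch L − 1)/L)` to second order -/

/-- **`log₃(2(ch L − 1)/L) = L/12 − L²/1440 + O(81‖L‖³)`** for `0 < ‖L‖₃ ≤ 3⁻⁴`: with
`u = 2(ch L − 1)/L − 1 = L/12 + L²/360 + D₃/L`, `‖D₃‖ ≤ 9‖L‖⁴` (`…SecondOrderSeries`), `‖u‖ ≤ 3‖L‖`,
`log₃(1+u) = u − u²/2 + O(3‖u‖³)` and `u² = L²/144 + O(27‖L‖³)`; `1/360 − 1/288 = −1/1440`.
[cite: Iwasawa1972PadicL, §4.4] -/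
theorem norm_padicLog_two_mul_coshOfSq_sub_one_div_sub_le {L : ℚ_[3]} (hL0 : L ≠ 0)
    (hL : ‖L‖ ≤ 1 / 81) :
    ‖padicLog 3 (2 * (coshOfSq L - 1) / L) - (L / 12 - L ^ 2 / 1440)‖ ≤ 81 * ‖L‖ ^ 3 := by
  obtain ⟨h2n, h4n, h3n, h3i, h9i, h12i, h360i, -, -, -⟩ := padic_three_constants
  have hLn : 0 < ‖L‖ := norm_pos_iff.mpr hL0
  have hL9 : ‖L‖ ≤ 1 / 9 := hL.trans (by norm_num)
  set D : ℚ_[3] := 2 * (coshOfSq L - 1) - L - L ^ 2 / 12 - L ^ 3 / 360 with hDdef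
  have hD : ‖D‖ ≤ 9 * ‖L‖ ^ 4 := norm_two_mul_coshOfSq_sub_cubic_le hL9
  clear_value D
  -- `u = L/12 + E`, `E = L²/360 + D/L`
  set u : ℚ_[3] := 2 * (coshOfSq L - 1) / L - 1 with hudef
  have hu_eq : u = L / 12 + (L ^ 2 / 360 + D / L) := by
    rw [hudef, hDdef]; field_simp; ring
  have hEn : ‖L ^ 2 / 360 + D / L‖ ≤ 9 * ‖L‖ ^ 2 := by
    refine (norm_add_le_max _ _).trans (max_le ?_ ?_)
    · rw [div_eq_mul_inv, norm_mul, h360i, norm_pow]; linarith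
    · rw [norm_div, div_le_iff₀ hLn]
      calc ‖D‖ ≤ 9 * ‖L‖ ^ 4 := hD
        _ = 9 * ‖L‖ ^ 2 * ‖L‖ * ‖L‖ := by ring
        _ ≤ 9 * ‖L‖ ^ 2 * 1 * ‖L‖ := by gcongr; exact hL.trans (by norm_num)
        _ = 9 * ‖L‖ ^ 2 * ‖L‖ := by ring
  have hL12 : ‖L / 12‖ = 3 * ‖L‖ := by rw [div_eq_mul_inv, norm_mul, h12i, mul_comm]
  have h3L : 3 * ‖L‖ ≤ 1 := by linarith
  have h9L2 : 9 * ‖L‖ ^ 2 ≤ 3 * ‖L‖ := by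
    calc 9 * ‖L‖ ^ 2 = (3 * ‖L‖) * (3 * ‖L‖) := by ring
      _ ≤ 1 * (3 * ‖L‖) := by gcongr
      _ = 3 * ‖L‖ := one_mul _
  have hun : ‖u‖ ≤ 3 * ‖L‖ := by
    rw [hu_eq]
    exact (norm_add_le_max _ _).trans (max_le hL12.le (hEn.trans h9L2))
  have hu3 : ‖u‖ ≤ 1 / 3 := hun.trans (by linarith)
  have hlog := norm_padicLog_one_add_sub_sub_le hu3
  have h1u : 1 + u = 2 * (coshOfSq L - 1) / L := by rw [hudef]; ring
  rw [h1u] at hlog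
  -- `u² = (L/12)² + E(2·L/12 + E)`
  have hfin : padicLog 3 (2 * (coshOfSq L - 1) / L) - (L / 12 - L ^ 2 / 1440) =
      (padicLog 3 (2 * (coshOfSq L - 1) / L) - (u - u ^ 2 / 2)) + D / L -
        (2 : ℚ_[3])⁻¹ * ((L ^ 2 / 360 + D / L) * (2 * (L / 12) + (L ^ 2 / 360 + D / L))) := by
    rw [hu_eq]; ring
  rw [hfin]
  refine (norm_sub_le_max₃ _ _).trans (max_le ((norm_add_le_max _ _).trans (max_le (hlog.trans ?_) ?_)) ?_)
  · calc 3 * ‖u‖ ^ 3 ≤ 3 * (3 * ‖L‖) ^ 3 := by gcongr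
      _ = 81 * ‖L‖ ^ 3 := by ring
  · rw [norm_div, div_le_iff₀ hLn]
    calc ‖D‖ ≤ 9 * ‖L‖ ^ 4 := hD
      _ ≤ 81 * ‖L‖ ^ 4 := by linarith [pow_nonneg (norm_nonneg L) 4]
      _ = 81 * ‖L‖ ^ 3 * ‖L‖ := by ring
  · rw [norm_mul, norm_inv, h2n, inv_one, one_mul, norm_mul]
    have h2 : ‖2 * (L / 12) + (L ^ 2 / 360 + D / L)‖ ≤ 3 * ‖L‖ := by
      refine (norm_add_le_max _ _).trans (max_le ?_ (hEn.trans h9L2))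
      rw [norm_mul, h2n, one_mul, hL12]
    calc ‖L ^ 2 / 360 + D / L‖ * ‖2 * (L / 12) + (L ^ 2 / 360 + D / L)‖ ≤ (9 * ‖L‖ ^ 2) * (3 * ‖L‖) := by
          gcongr
      _ = 27 * ‖L‖ ^ 3 := by ring
      _ ≤ 81 * ‖L‖ ^ 3 := by linarith [pow_nonneg (norm_nonneg L) 3]

end Summit.BirchSwinnertonDyer.Rank1Residual.X11b.RegMult.HeightLogNumerator

end
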